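import Mathlib
import HarnessLib
import Literature.Analysis.FluidPDE.ClassicalSolution
import Literature.Analysis.FluidPDE.LerayHopf
import Literature.Analysis.FluidPDE.SuitableWeak
import Literature.Analysis.FluidPDE.TypeIAncientMild
import Summits.NavierStokesRegularity.NavierStokesRegularity.Theorems.TypeIQuarterGateScarZoomDefs

/-!
# Line `scar_zoom` on crux `TypeIQuarterGate.ScarEnvelopeTypeI` (stmt-NavierStokesRegularity-23843) —
# STUB A `stub_violatorsApproachScar`: envelope violators accumulate parabolically far from a scar

The registered stub `stub_violatorsApproachScar` (skeleton `Cruxes/ScarEnvelopeTypeI/Lines/scar_zoom.lean`,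
sha16 `c570de7ba4c3`, line owner ns-idea-7 g0, critic idea-crit-7 PASS-WITH-PRICE) proved VERBATIM:

  `CruxHypotheses ν T u p → TameOutside T u → ¬ Envelope T u → ScarViolators T u`.

Proof (elementary, the critic's P2 reading).  Take the envelope's scar set equal to the hypothesis'
finite scar set `σ` and the constant `C' := k ∈ ℕ`; `¬ Envelope` yields violators `(t_k, x_k)`,
`t_k ∈ [0,T)`, with `‖u(t_k,x_k)‖ > k + Σ_{a∈σ} k/(‖x_k − a‖ + √(T − t_k))`, in particular `> k` and
`> k/(‖x_k − a‖ + √(T − t_k))` for each `a ∈ σ`.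
* `t_k → T`: `TameOutside` bounds `u` on `[0,T−δ] × ℝ³` and on `[T−δ,T) × {R ≤ ‖x‖}`, and joint
  continuity (`IsClassicalNSSolutionOn` on `Ico 0 T`) bounds it on the compact
  `[max 0 (T−δ), T−δ₁] × B̄_R`; so `u` is bounded on `[0, T−δ₁] × ℝ³` for every `δ₁ > 0`
  (`bounded_before_of_tameOutside`), forcing `t_k > T − δ₁` eventually.
* eventually `‖x_k‖ ≤ R` (far-field clause), so a subsequence `x_{φ k} → b`; `b ∉ σ` contradicts the
  finite-scar clause (bounded backward parabolic neighbourhood of `b`), hence `b ∈ σ`.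
* the Type-I rate `‖u(t,x)‖ ≤ C/√(T−t)` for `t` near `T` (w.l.o.g. `C ≥ 1`) against
  `k/(d + s) < ‖u‖`, `d = ‖x_k − b‖`, `s = √(T − t_k)`, gives `(k − C) s < C d`; for `k ≥ 2C`:
  `s < d` (so `x_k ≠ b` and `d‖u‖ ≥ d·k/(d+s) ≥ k/2`) and `(T − t_k)/d² ≤ 4C²/k`.
* the final sequence is `k ↦ (x, t) (φ (k + N))` for `N` past the finitely many bad indices; the
  limits follow by squeezing against `4C²/φ(k+N) → 0` and `φ(k+N)/2 → ∞`.

Only `0 < T`-free parts of `CruxHypotheses` are used: joint smoothness of the maximal solution, the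
Type-I rate and the finite-scar clause (the Leray–Hopf / decay clauses are not needed here).
No statement about the crux, its parent `QuarterLawTypeI` or the summit is proved by this file.
-/

noncomputable section

-- the summit-side namespace `Summit.NavierStokesRegularity.NavierStokesRegularity.…` (single-conjunct
-- summit, D-0017) repeats a component by design; the dupNamespace linter would flag every declaration.
set_option linter.dupNamespace false

namespace Summit.NavierStokesRegularity.NavierStokesRegularity.Cruxes.ScarEnvelopeTypeI.ScarZoom

open MeasureTheory Filter Set Metric
open scoped Topology

local notation "E3" => EuclideanSpace ℝ (Fin 3)

/-! ### Early-time boundedness from tameness and joint continuity -/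

/-- If `u` is jointly continuous on `[0,T) × ℝ³` and tame outside the blow-up region, then for every
`δ₁ > 0` it is bounded on the whole slab `[0, T − δ₁] × ℝ³`: the early slab and the far field are
covered by `TameOutside`, the remaining `[max 0 (T−δ), T−δ₁] × B̄_R` is compact. -/
theorem bounded_before_of_tameOutside {T : ℝ} {u : ℝ → E3 → E3}
    (hcont : ContinuousOn (Function.uncurry u) (Ico 0 T ×ˢ univ)) (htame : TameOutside T u)
    {δ₁ : ℝ} (hδ₁ : 0 < δ₁) :
    ∃ B₁ : ℝ, ∀ t ∈ Icc 0 (T - δ₁), ∀ x : E3, ‖u t x‖ ≤ B₁ := by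
  obtain ⟨δ, R, B, -, h1, h2⟩ := htame
  set K : Set (ℝ × E3) := Icc (max 0 (T - δ)) (T - δ₁) ×ˢ closedBall (0 : E3) R with hK
  have hKc : IsCompact K := isCompact_Icc.prod (isCompact_closedBall _ _)
  have hKsub : K ⊆ Ico 0 T ×ˢ univ := by
    rintro ⟨s, y⟩ ⟨hs, -⟩
    refine ⟨⟨le_trans (le_max_left _ _) hs.1, ?_⟩, mem_univ _⟩
    linarith [hs.2]
  obtain ⟨C, hC⟩ := hKc.exists_bound_of_continuousOn (hcont.mono hKsub)
  refine ⟨max B C, fun s hs y => ?_⟩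
  by_cases hsδ : s ≤ T - δ
  · exact (h1 s ⟨hs.1, hsδ⟩ y).trans (le_max_left _ _)
  · push Not at hsδ
    by_cases hy : R ≤ ‖y‖
    · exact (h2 s ⟨hsδ.le, by linarith [hs.2]⟩ y hy).trans (le_max_left _ _)
    · push Not at hy
      have hmem : (s, y) ∈ K :=
        ⟨⟨max_le hs.1 hsδ.le, hs.2⟩, mem_closedBall_zero_iff.2 hy.le⟩
      have h := hC (s, y) hmem
      simp only [Function.uncurry_apply_pair] at h
      exact h.trans (le_max_right _ _)

/-! ### STUB A -/

/-- **STUB A of line `scar_zoom` (registered signature, verbatim).**  Under the crux hypotheses and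
tameness outside the blow-up region, failure of the multi-scar envelope produces ENVELOPE VIOLATORS at
a scar `a ∈ σ`: a sequence `(x_k, t_k) → (a, T)` in `[0,T) × (ℝ³ ∖ {a})`, parabolically far from
`a` (`(T − t_k)/‖x_k − a‖² → 0`), with `‖x_k − a‖ · ‖u (t_k) (x_k)‖ → ∞`.  Elementary from the
eventual Type-I rate, the finite-scar clause, tameness and joint continuity (see the module
docstring for the proof). -/
theorem stub_violatorsApproachScar :
    ∀ (ν T : ℝ) (u : ℝ → E3 → E3) (p : ℝ → E3 → ℝ),
      CruxHypotheses ν T u p → TameOutside T u → ¬ Envelope T u → ScarViolators T u := by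
  intro _ T u _ hH htame hnotEnv
  obtain ⟨-, -, hmax, -, -, hTI, σ, hσ⟩ := hH
  have hcont : ContinuousOn (Function.uncurry u) (Ico 0 T ×ˢ univ) :=
    ContDiffOn.continuousOn hmax.1.smooth_velocity
  -- Step 1: violators of the envelope with scar set `σ` and constant `k`
  have hviol : ∀ k : ℕ, ∃ t ∈ Ico 0 T, ∃ x : E3,
      (k : ℝ) + ∑ a ∈ σ, (k : ℝ) / (‖x - a‖ + Real.sqrt (T - t)) < ‖u t x‖ := by
    intro k
    by_contra h
    push Not at h
    exact hnotEnv ⟨σ, k, h⟩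
  choose t ht x hx using hviol
  have hsqrt_pos : ∀ k, 0 < Real.sqrt (T - t k) := fun k =>
    Real.sqrt_pos.2 (by linarith [(ht k).2])
  have hden_pos : ∀ k (a : E3), 0 < ‖x k - a‖ + Real.sqrt (T - t k) := fun k a =>
    add_pos_of_nonneg_of_pos (norm_nonneg _) (hsqrt_pos k)
  have hterm_nn : ∀ k : ℕ, ∀ a ∈ σ, 0 ≤ (k : ℝ) / (‖x k - a‖ + Real.sqrt (T - t k)) :=
    fun k a _ => div_nonneg (Nat.cast_nonneg k) (hden_pos k a).le
  have hk_lt : ∀ k : ℕ, (k : ℝ) < ‖u (t k) (x k)‖ := fun k =>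
    lt_of_le_of_lt (le_add_of_nonneg_right (Finset.sum_nonneg (hterm_nn k))) (hx k)
  have hterm_lt : ∀ k : ℕ, ∀ a ∈ σ,
      (k : ℝ) / (‖x k - a‖ + Real.sqrt (T - t k)) < ‖u (t k) (x k)‖ := by
    intro k a ha
    have h1 : (k : ℝ) / (‖x k - a‖ + Real.sqrt (T - t k)) ≤
        ∑ b ∈ σ, (k : ℝ) / (‖x k - b‖ + Real.sqrt (T - t k)) :=
      Finset.single_le_sum (hterm_nn k) ha
    have h2 : (0 : ℝ) ≤ k := Nat.cast_nonneg k
    linarith [hx k]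
  -- Step 2: `t k → T`
  have ht_tend : Tendsto t atTop (𝓝 T) := by
    rw [Metric.tendsto_atTop]
    intro ε hε
    obtain ⟨B₁, hB₁⟩ := bounded_before_of_tameOutside hcont htame hε
    refine ⟨⌈B₁⌉₊, fun k hk => ?_⟩
    have hkB : B₁ ≤ k := (Nat.le_ceil B₁).trans (by exact_mod_cast hk)
    have hnot : ¬ t k ≤ T - ε := fun hle =>
      absurd (hB₁ (t k) ⟨(ht k).1, hle⟩ (x k)) (not_le.2 (lt_of_le_of_lt hkB (hk_lt k)))
    rw [Real.dist_eq, abs_sub_lt_iff]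
    constructor <;> linarith [(ht k).2]
  -- Step 3: eventually `‖x k‖ ≤ R` (far-field clause of tameness)
  obtain ⟨δ, R, B, hδ, -, hfar⟩ := htame
  have hx_ball : ∀ᶠ k in atTop, x k ∈ closedBall (0 : E3) R := by
    have h1 : ∀ᶠ k in atTop, T - δ < t k := ht_tend.eventually (lt_mem_nhds (by linarith))
    have h2 : ∀ᶠ k : ℕ in atTop, B ≤ (k : ℝ) := tendsto_natCast_atTop_atTop.eventually_ge_atTop B
    filter_upwards [h1, h2] with k hk1 hk2
    rw [mem_closedBall_zero_iff]
    by_contra hR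
    push Not at hR
    exact absurd (hfar (t k) ⟨hk1.le, (ht k).2⟩ (x k) hR.le)
      (not_le.2 (lt_of_le_of_lt hk2 (hk_lt k)))
  -- Step 4: a convergent subsequence `x ∘ φ → b`
  obtain ⟨b, -, φ, hφ, hxφ⟩ :=
    (isCompact_closedBall (0 : E3) R).tendsto_subseq' hx_ball.frequently
  have hφ_ge : ∀ k, k ≤ φ k := fun k => hφ.id_le k
  have htφ : Tendsto (t ∘ φ) atTop (𝓝 T) := ht_tend.comp hφ.tendsto_atTop
  -- Step 5: the limit point is a scar, `b ∈ σ`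
  have hb : b ∈ σ := by
    by_contra hb
    obtain ⟨r, hr, A, hA⟩ := hσ b hb
    have h1 : ∀ᶠ k in atTop, T - r ^ 2 < (t ∘ φ) k :=
      htφ.eventually (lt_mem_nhds (by nlinarith))
    have h2 : ∀ᶠ k in atTop, (x ∘ φ) k ∈ ball b r := hxφ.eventually_mem (ball_mem_nhds b hr)
    have h3 : ∀ᶠ k : ℕ in atTop, A ≤ (k : ℝ) := tendsto_natCast_atTop_atTop.eventually_ge_atTop A
    obtain ⟨k, hk1, hk2, hk3⟩ := (h1.and (h2.and h3)).exists
    have hle : ‖u (t (φ k)) (x (φ k))‖ ≤ A := hA _ ⟨hk1.le, (ht _).2⟩ _ hk2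
    have hge : A < ‖u (t (φ k)) (x (φ k))‖ :=
      lt_of_le_of_lt (hk3.trans (by exact_mod_cast hφ_ge k)) (hk_lt (φ k))
    linarith
  -- Step 6: the Type-I rate along the sequence (w.l.o.g. constant `C ≥ 1`)
  obtain ⟨C₀, hC₀⟩ := hTI
  obtain ⟨l, hlT, hl⟩ := mem_nhdsLT_iff_exists_Ioo_subset.1 hC₀
  set C : ℝ := max C₀ 1 with hCdef
  have hC1 : 1 ≤ C := le_max_right _ _
  have hrate : ∀ k, l < t k → ‖u (t k) (x k)‖ ≤ C / Real.sqrt (T - t k) := by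
    intro k hk
    have h : ∀ y : E3, ‖u (t k) y‖ ≤ C₀ / Real.sqrt (T - t k) := hl ⟨hk, (ht k).2⟩
    refine (h (x k)).trans ?_
    gcongr
    exact le_max_left _ _
  -- Step 7: the key estimates for all large indices
  obtain ⟨N₁, hN₁⟩ : ∃ N₁ : ℕ, ∀ k ≥ N₁, l < t k :=
    eventually_atTop.1 (ht_tend.eventually (lt_mem_nhds hlT))
  set N : ℕ := max N₁ ⌈2 * C⌉₊ with hNdef
  have hN_rate : ∀ k, N ≤ k → l < t k := fun k hk => hN₁ k ((le_max_left _ _).trans hk)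
  have hN_C : ∀ k, N ≤ k → 2 * C ≤ (k : ℝ) := fun k hk =>
    (Nat.le_ceil (2 * C)).trans (by exact_mod_cast (le_max_right _ _).trans hk)
  have hkey : ∀ k : ℕ, N ≤ k →
      x k ≠ b ∧ (T - t k) / ‖x k - b‖ ^ 2 ≤ 4 * C ^ 2 / (k : ℝ) ∧
        (k : ℝ) / 2 ≤ ‖x k - b‖ * ‖u (t k) (x k)‖ := by
    intro k hk
    have hsk : 0 < T - t k := by linarith [(ht k).2]
    have hss : Real.sqrt (T - t k) ^ 2 = T - t k := Real.sq_sqrt hsk.le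
    set s : ℝ := Real.sqrt (T - t k) with hs
    set d : ℝ := ‖x k - b‖ with hd
    have hs_pos : 0 < s := hsqrt_pos k
    have hd_nn : 0 ≤ d := norm_nonneg _
    have hkC : 2 * C ≤ (k : ℝ) := hN_C k hk
    have hU : (k : ℝ) / (d + s) < ‖u (t k) (x k)‖ := hterm_lt k b hb
    have hR : ‖u (t k) (x k)‖ ≤ C / s := hrate k (hN_rate k hk)
    have hds : 0 < d + s := by linarith
    have h1 : (k : ℝ) / (d + s) < C / s := lt_of_lt_of_le hU hR
    have h2 : (k : ℝ) * s < C * (d + s) := (div_lt_div_iff₀ hds hs_pos).1 h1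
    -- `(k - C) s < C d`, and `C ≤ k - C`
    have h3 : ((k : ℝ) - C) * s < C * d := by nlinarith
    have hkC' : C ≤ (k : ℝ) - C := by linarith
    have h4 : s < d := by
      have h5 : C * d ≤ ((k : ℝ) - C) * d := mul_le_mul_of_nonneg_right hkC' hd_nn
      have h6 : ((k : ℝ) - C) * s < ((k : ℝ) - C) * d := lt_of_lt_of_le h3 h5
      exact lt_of_mul_lt_mul_left h6 (by linarith)
    have hd_pos : 0 < d := lt_of_le_of_lt hs_pos.le h4
    refine ⟨?_, ?_, ?_⟩
    · intro hxe
      have : d = 0 := by rw [hd, hxe, sub_self, norm_zero]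
      linarith
    · have hk_pos : (0 : ℝ) < k := by linarith
      have hk1 : (1 : ℝ) ≤ k := by linarith
      -- `k s ≤ 2 (k - C) s < 2 C d`
      have h6 : (k : ℝ) * s ≤ 2 * C * d := by
        have := mul_nonneg (sub_nonneg.2 hkC) hs_pos.le
        nlinarith
      have h7 : ((k : ℝ) * s) ^ 2 ≤ (2 * C * d) ^ 2 := pow_le_pow_left₀ (by positivity) h6 2
      rw [← hss, div_le_div_iff₀ (pow_pos hd_pos 2) hk_pos]
      have h8 := mul_nonneg (mul_nonneg (sq_nonneg s) hk_pos.le) (sub_nonneg.2 hk1)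
      nlinarith [h7, h8]
    · have h9 : (k : ℝ) / 2 ≤ d * ((k : ℝ) / (d + s)) := by
        rw [mul_div_assoc', le_div_iff₀ hds]
        have := mul_le_mul_of_nonneg_left h4.le (Nat.cast_nonneg k : (0 : ℝ) ≤ k)
        nlinarith
      exact h9.trans (mul_le_mul_of_nonneg_left hU.le hd_nn)
  -- Step 8: the final sequence `k ↦ (x, t) (φ (k + N))`
  have hφN : ∀ k, N ≤ φ (k + N) := fun k => le_trans (Nat.le_add_left N k) (hφ_ge (k + N))
  have hψ : Tendsto (fun k => φ (k + N)) atTop atTop :=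
    hφ.tendsto_atTop.comp (tendsto_add_atTop_nat N)
  refine ⟨b, fun k => x (φ (k + N)), fun k => t (φ (k + N)), fun k => ht _,
    fun k => (hkey _ (hφN k)).1, ht_tend.comp hψ, hxφ.comp (tendsto_add_atTop_nat N), ?_, ?_⟩
  · have hup : Tendsto (fun k => 4 * C ^ 2 / ((φ (k + N) : ℕ) : ℝ)) atTop (𝓝 0) :=
      (tendsto_const_div_atTop_nhds_zero_nat (4 * C ^ 2)).comp hψ
    refine tendsto_of_tendsto_of_tendsto_of_le_of_le tendsto_const_nhds hup
      (fun k => ?_) (fun k => (hkey _ (hφN k)).2.1)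
    exact div_nonneg (by linarith [(ht (φ (k + N))).2]) (sq_nonneg _)
  · have hlow : Tendsto (fun k => ((φ (k + N) : ℕ) : ℝ) / 2) atTop atTop :=
      (tendsto_natCast_atTop_atTop.comp hψ).atTop_div_const (by norm_num)
    exact tendsto_atTop_mono (fun k => (hkey _ (hφN k)).2.2) hlow

end Summit.NavierStokesRegularity.NavierStokesRegularity.Cruxes.ScarEnvelopeTypeI.ScarZoom

end
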